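import Summits.AtomisticToContinuum.HydrodynamicLimit.Theorems.CollisionIsometryCLTCollisionalTransferLocalityBalanceIdentity
import Literature.Analysis.FluidPDE.CollisionalTransferTimeDep
import Literature.Analysis.FluidPDE.HardSphereDynamicsProofs
import Literature.MathematicalPhysics.KineticTheory.HardSphereEuler
import HarnessLib

/-!
# `FluxClosure` (route `BoxDissipativeWeakStrong`), stub B1: the slab-localised weak balance law

The weak balance law for a time-dependent observable along a hard-sphere trajectory on `𝕋³`,
with hypotheses on a time slab `[0, T')` only (line `birth` of the crux `FluxClosure`).

Support file (`--supports stmt-AtomisticToContinuum-9902`) landing the registered stub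
`stub_tdBalanceLawLocal` of the lead skeleton of the crux
`Summit.AtomisticToContinuum.HydrodynamicLimit.Theses.BoxDissipativeWeakStrong.FluxClosure`
(kinetic/collisional split of the box momentum-balance defect; the exact pathwise balance law is
the seam).

The prelude `Literature.Analysis.FluidPDE.CollisionalTransferTimeDep` proves, for an observable
`F t z` with streaming derivative `F' t z` along free flight, the bookkeeping identity
`F b (γ b) - F a (γ a) = ∫_a^b F' s (γ s) ds + Σᶠ_{t ∈ C ∩ (a, b]} [F t (γ t) - F t (γ t⁻)]`
along a hard-sphere trajectory `γ`
(`IsHardSphereTrajectory.sub_eq_integral_add_finsum_collisionJump_td`), under GLOBAL-in-time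
hypotheses on the free flights `s ↦ F s (S_{s-t₀} z)`. The observable of the line is built from a
test field smooth on `[0, T') × 𝕋³` only, so the lead needs the same identity with hypotheses on
the slab: along every free flight `s ↦ F s (S_{s-t₀} z)` is continuous on `[0, T')`, has derivative
`F' s (S_{s-t₀} z)` at every `s ∈ (0, T')`, and `s ↦ F' s (S_{s-t₀} z)` is continuous on
`[0, T')`; conclusion on windows `0 ≤ a ≤ b < T'`.

Proof: the tree already contains the window-localised law
`HemisphereAffineSlaving.BalanceIdentity.sub_eq_integral_add_finsum_collisionJump_loc`
(`Theorems/CollisionIsometryCLTCollisionalTransferLocalityBalanceIdentity`, any geometry with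
continuous translations and Hausdorff positions: continuity on `[A, B]`, interior derivatives,
interval integrability of the streaming term on `[A, B]`; induction on the finitely many collision
times in `(a, b]`, FTC `intervalIntegral.integral_eq_sub_of_hasDerivAt_of_le` on each free stretch,
`leftLim_eq_freeFlight` / `leftLim_eq_of_not_mem` for the one-sided limits). We apply it on the
window `[A, B] = [0, b] ⊆ [0, T')`: the slab hypotheses restrict to `[0, b]` and `(0, b)`, the
streaming term is interval integrable on `[0, b]` by continuity on the compact interval
(`ContinuousOn.intervalIntegrable_of_Icc`), and torus translations `v ↦ x + proj v` are continuous
(`HemisphereAffineSlaving.BalanceIdentity.torus_continuous_translate`, from `Torus.continuous_proj`).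

References: H. Spohn, *Large Scale Dynamics of Interacting Particles* (1991), Part I §3.2,
(3.3)–(3.8) (weak form of the empirical conservation laws against time-dependent tests);
R. Soto, *Kinetic Theory and Transport Phenomena* (2016), §4.8.1 (collisional transfer).
-/

noncomputable section

namespace Summit.AtomisticToContinuum.HydrodynamicLimit.Theorems
namespace FluxClosureB1

open scoped BigOperators Topology Classical MeasureTheory ProbabilityTheory InnerProductSpace ENNReal
open Filter Set Function MeasureTheory
open Literature.MathematicalPhysics.KineticTheory Literature.Analysis.FluidPDE Literature.Analysis.FunctionSpaces

/-- **Stub B1 — the localised weak balance law for a time-dependent observable along a hard-sphere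
trajectory on `𝕋³`.** Let `γ` be a hard-sphere trajectory of `N` spheres of diameter `ε` on the flat
torus and let `F, F' : ℝ → Config → ℝ`. If along every free flight `s ↦ F s (S_{s-t₀} z)` is
continuous on `[0, T')`, has derivative `F' s (S_{s-t₀} z)` at every `s ∈ (0, T')`, and
`s ↦ F' s (S_{s-t₀} z)` is continuous on `[0, T')`, then for `0 ≤ a ≤ b < T'` the streaming term
`s ↦ F' s (γ s)` is interval integrable on `[a, b]` and
`F b (γ b) - F a (γ a) = ∫_a^b F' s (γ s) ds + Σᶠ_{t ∈ C ∩ (a, b]} collisionJump (F t) γ t`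
(Spohn 1991, Part I §3.2 (3.3)–(3.8), tested against functions smooth on a time slab). Deduced from
`HemisphereAffineSlaving.BalanceIdentity.sub_eq_integral_add_finsum_collisionJump_loc` on the window
`[0, b]`. -/
theorem stub_tdBalanceLawLocal : ∀ (N : ℕ) (ε : ℝ) (γ : ℝ → Config N (Fin 3) T3), IsHardSphereTrajectory (Torus.geometry (Fin 3)) ε N γ → ∀ (T' : ℝ) (F F' : ℝ → Config N (Fin 3) T3 → ℝ), (∀ (z : Config N (Fin 3) T3) (t₀ : ℝ), ContinuousOn (fun s => F s (freeFlight (Torus.geometry (Fin 3)) (s - t₀) z)) (Ico 0 T')) → (∀ (z : Config N (Fin 3) T3) (t₀ : ℝ), ∀ t ∈ Ioo 0 T', HasDerivAt (fun s => F s (freeFlight (Torus.geometry (Fin 3)) (s - t₀) z)) (F' t (freeFlight (Torus.geometry (Fin 3)) (t - t₀) z)) t) → (∀ (z : Config N (Fin 3) T3) (t₀ : ℝ), ContinuousOn (fun t => F' t (freeFlight (Torus.geometry (Fin 3)) (t - t₀) z)) (Ico 0 T')) → ∀ a b : ℝ, 0 ≤ a → a ≤ b → b < T' → IntervalIntegrable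 (fun s => F' s (γ s)) volume a b ∧ F b (γ b) - F a (γ a) = (∫ s in a..b, F' s (γ s)) + ∑ᶠ t ∈ collisionTimes (Torus.geometry (Fin 3)) ε γ ∩ Ioc a b, collisionJump (F t) γ t := by
  intro N ε γ hγ T' F F' hFc hFd hF'c a b ha hab hbT'
  -- the window `[0, b]` lies in the slab `[0, T')`
  have hsub : Icc (0 : ℝ) b ⊆ Ico 0 T' := Icc_subset_Ico_right hbT'
  have hF : ∀ (z : Config N (Fin 3) T3) (t₀ : ℝ), ∀ s ∈ Ioo (0 : ℝ) b,
      HasDerivAt (fun s => F s (freeFlight (Torus.geometry (Fin 3)) (s - t₀) z))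
        (F' s (freeFlight (Torus.geometry (Fin 3)) (s - t₀) z)) s :=
    fun z t₀ s hs => hFd z t₀ s ⟨hs.1, hs.2.trans hbT'⟩
  have hFc' : ∀ (z : Config N (Fin 3) T3) (t₀ : ℝ),
      ContinuousOn (fun s => F s (freeFlight (Torus.geometry (Fin 3)) (s - t₀) z)) (Icc 0 b) :=
    fun z t₀ => (hFc z t₀).mono hsub
  have hF'i : ∀ (z : Config N (Fin 3) T3) (t₀ : ℝ),
      IntervalIntegrable (fun s => F' s (freeFlight (Torus.geometry (Fin 3)) (s - t₀) z))
        volume 0 b :=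
    fun z t₀ => ((hF'c z t₀).mono hsub).intervalIntegrable_of_Icc (ha.trans hab)
  exact HemisphereAffineSlaving.BalanceIdentity.sub_eq_integral_add_finsum_collisionJump_loc hγ
    HemisphereAffineSlaving.BalanceIdentity.torus_continuous_translate hF hFc' hF'i ha hab le_rfl

end FluxClosureB1
end Summit.AtomisticToContinuum.HydrodynamicLimit.Theorems

end
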